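import Summits.BirchSwinnertonDyer.BirchSwinnertonDyer.Theorems.KimAtThreeKolyvaginIsogenyInvariance
import Literature.NumberTheory.EllipticCurves.CyclotomicLineWeilPairingProofs
import Literature.NumberTheory.EllipticCurves.TateModuleGaloisTransportProofs
import Literature.NumberTheory.EllipticCurves.IrreducibleModPQuadraticTwistProofs
import Summits.BirchSwinnertonDyer.BirchSwinnertonDyer.Theorems.AdditiveKolyvaginRoadManinFrameResidueProperRTorsTwistPrelim
import HarnessLib

/-!
# TORS-TWIST: a unit quadratic twist by a non-residue kills `ℚ_p`-rational `p`-torsion on the whole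
# isogeny class (route `AdditiveKolyvaginRoad`, crux `ManinFrameResidueProperR` = stmt-BirchSwinnertonDyer-20709,
# line `tame_twist`, Kosters–Pannekoek sub-residue of the stub `stub_memberManinUnit_fiveSeven_torsion`) — `--supports`

Cell `pub/bsd-wall`, seat `bsd-wall-manin-p1` (g6). THEOREMS ONLY (no definition, no named fact, no `sorry`);
route-free mathematics (no `Theses` import). Nothing is closed and BSD is not proved by this file.

`torsTwist` is, VERBATIM, the hypothesis `hTT` ("TORS-TWIST") of the landed conditional theorems
`TwistDegreeStepFiveSevenKP.twistDegreeStepFiveSeven_of_kato_of_twistInputs` (route `EdixhovenFibreFiveSeven`,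
crux TDS57 = stmt-22227) and `ManinFrameResidueProperRTameTwistUnitTwist.stub_memberManinUnit_fiveSeven_torsion_of_twistInputs`
(route `AdditiveKolyvaginRoad`, crux 20709): for a prime `p ≥ 5`, a prime `q ≠ p` with `q* = (−1)^{(q−1)/2} q` a
non-square mod `p`, and `V₀/ℚ` with `E[p]` irreducible, if SOME member of the `ℚ`-isogeny class of `V₀` has a
non-zero `ℚ_p`-rational `p`-torsion point then NO member of the class of `V₀ ⊗ χ_{q*}` has one. With it, both
conditional theorems lose their TORS-TWIST hypothesis (companion files `…TameTwistFull57LTwist`,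
`…TwistDegreeStepFiveSevenLTwist`): the Kosters–Pannekoek sub-residue is conditional on F″ and L-TWIST only.

## Proof (`eq_zero_of_twist_nonsquare`)

Elementary local Galois theory, assembled from tree theorems:
* out of a curve with `E[p]` irreducible every isogeny class mate is reached by an isogeny of degree prime to
  `p` (`SkinnerUrban2014.exists_isogeny_not_dvd_degree_of_irreducible`, *AEC* III.4.11), which restricts to a
  `Γ_ℚ`-equivariant `E[p] ≅ E'[p]` (`KimAtThreeKolyvaginIsogenyInvariance.exists_torsionAddEquiv_of_coprime`);
* the twist isomorphism `V₀^{(u)}(ℚ̄) ≃ V₀(ℚ̄)`, equivariant up to the sign `σ√u = ±√u`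
  (`exists_addEquiv_geomPoints_quadraticTwist_sign`, *AEC* X.5.4), and the change of variables `v`
  (`VariableChange.pointEquivBaseChange`); irreducibility passes to the twist
  (`hasIrreducibleModPGaloisRep_iff_of_addEquiv_geomPoints_signed`);
* a `ℚ_p`-rational `p`-torsion point is a geometric `p`-torsion point fixed by the decomposition group
  `Γ_{ℚ_p} → Γ_ℚ` (`torsionPointsEquiv`, `resGal`, `pointsMap`; *AEC* III.6.4, VIII.§1);
* `u = q*` is not a square in `ℚ_p` (it is a `p`-adic unit and a non-square mod `p`: `PadicInt.toZMod`), so some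
  `σ₀ ∈ Γ_{ℚ_p}` moves `√u` (Galois descent in `ℚ̄_p`, Mathlib `InfiniteGalois.mem_range_algebraMap_iff_fixed`);
* hence in `W''[p]` (`#W''[p] = p²`, `card_torsionPoints_eq_sq_holds`) a rational `Q ≠ 0` and the transported
  point `P₁` (on which `Γ_{ℚ_p}` acts through the quadratic character of `ℚ_p(√u)`) form a basis, and the Weil
  pairing (`localPoints_exists_isPrimitiveRoot_smul_eq_pow`, *AEC* III.8.1: `det ρ̄ = ω`) yields a primitive
  `p`-th root of unity `ζ ∈ ℚ̄_p` with `σζ ∈ {ζ, ζ⁻¹}` for all `σ ∈ Γ_{ℚ_p}`;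
* that is absurd for `p ≥ 5`: `ζ + ζ⁻¹ ∈ ℚ_p` makes `ζ` quadratic over `ℚ_p`, while `Φ_p` is irreducible over
  `ℚ_p` (Eisenstein at `p`), of degree `p − 1 ≥ 4` (`false_of_isPrimitiveRoot_of_forall_smul`, companion file
  `…TorsTwistPrelim`, where also the descent lemmas and the two-generator lemma live).

References: J. H. Silverman, *AEC* (2009), III.4.11, III.6.4, III.8.1, VIII.§1, X.5.4 [SilvermanAEC2009];
J.-P. Serre, *Local Fields* (1979), IV.§4 Prop. 17 [SerreLocalFields1979]; F. Q. Gouvêa, *p-adic Numbers*,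
Thm. 6.3.11 [Gouvea1993PadicNumbers]; M. Kosters, R. Pannekoek, *On the structure of elliptic curves over finite
extensions of ℚ_p with additive reduction* (2017), Cor. 2 [KostersPannekoek2017] (context only).
-/

set_option autoImplicit false
set_option linter.dupNamespace false

noncomputable section

open scoped Classical

open Polynomial WeierstrassCurve Field Literature.NumberTheory.EllipticCurves
  Summit.BirchSwinnertonDyer.BirchSwinnertonDyer.Theorems.KimAtThreeKolyvaginIsogenyInvariance

namespace Summit.BirchSwinnertonDyer.BirchSwinnertonDyer.Theorems.TorsTwist

/-- **TORS-TWIST, core form.** Let `p ≥ 5` be prime, `u ∈ ℤ` a non-square modulo `p`, `V₀/ℚ` an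
elliptic curve with `E[p]` irreducible, `W' ∼ V₀` a `ℚ`-isogenous curve with a non-zero `ℚ_p`-rational
`p`-torsion point, `Vχ ≅ V₀ ⊗ χ_u` (`v • V₀^{(u)} = Vχ`) and `W'' ∼ Vχ`. Then `W''(ℚ_p)[p] = 0`.
Proof: prime-to-`p` isogenies `V₀ → W'`, `Vχ → W''` (irreducibility, *AEC* III.4.11) and the twist
isomorphism `V₀^{(u)}(ℚ̄) ≃ V₀(ℚ̄)` (sign-equivariant w.r.t. `σ√u = ±√u`) carry the rational point to a
`p`-torsion point `P₁ ∈ W''(ℚ̄)` on which the decomposition group `Γ_{ℚ_p}` acts through the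
quadratic character of `ℚ_p(√u)/ℚ_p` — non-trivial because `u` is a `p`-adic unit non-square mod `p`;
with a rational `Q ≠ 0` the pair `{Q, P₁}` is a basis of `W''[p]`, and the Weil pairing
(`det ρ̄ = ω`, tree `localPoints_exists_isPrimitiveRoot_smul_eq_pow`) produces a primitive `p`-th
root of unity moved by `Γ_{ℚ_p}` only within `{ζ, ζ⁻¹}`, impossible for `p ≥ 5`
(`false_of_isPrimitiveRoot_of_forall_smul`). [cite: SilvermanAEC2009, III.8.1, X.5 Cor. 5.4]
[cite: SerreLocalFields1979, IV.§4 Prop. 17] -/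
theorem eq_zero_of_twist_nonsquare (p : ℕ) [Fact p.Prime] (hp5 : 5 ≤ p) (u : ℤ)
    (hnsq : ¬ IsSquare ((u : ℤ) : ZMod p))
    (V₀ W' Vχ W'' : WeierstrassCurve ℚ) [V₀.IsElliptic] [W'.IsElliptic] [Vχ.IsElliptic]
    [W''.IsElliptic] (hirr : V₀.HasIrreducibleModPGaloisRep p) (hW' : IsIsogenous V₀ W')
    (P : (W'.baseChange ℚ_[p]).toAffine.Point) (hP0 : P ≠ 0) (hP : p • P = 0)
    (v : VariableChange ℚ) (hv : v • V₀.quadraticTwist (u : ℚ) = Vχ) (hW'' : IsIsogenous Vχ W'')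
    (Q : (W''.baseChange ℚ_[p]).toAffine.Point) (hQ : p • Q = 0) : Q = 0 := by
  by_contra hQ0
  have hp : p.Prime := Fact.out
  have hp0 : ((p : ℕ) : ℤ) ≠ 0 := by exact_mod_cast hp.ne_zero
  have hpQ : (p : ℚ) ≠ 0 := by exact_mod_cast hp.ne_zero
  have hu0 : (u : ℚ) ≠ 0 := by
    rintro h
    have h' : u = 0 := by exact_mod_cast h
    exact hnsq ⟨0, by rw [h']; simp⟩
  -- the square root of `u` and the sign dichotomy
  set s : AlgebraicClosure ℚ := geomSqrt (u : ℚ) with hs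
  have hdich : ∀ τ : absoluteGaloisGroup ℚ, τ • s = s ∨ τ • s = -s := fun τ ↦
    map_geomSqrt (absoluteGaloisGroup.toAlgEquiv ℚ τ) (u : ℚ)
  have hsne : s ≠ -s := fun h ↦ by
    have h2 : (2 : AlgebraicClosure ℚ) * s = 0 := by rw [two_mul]; nth_rw 2 [h]; rw [add_neg_cancel]
    rcases mul_eq_zero.mp h2 with h0 | h0
    · exact two_ne_zero h0
    · exact geomSqrt_ne_zero hu0 h0
  -- (1) some `σ₀ ∈ Γ_{ℚ_p}` moves `√u` (`u` is not a square in `ℚ_p`)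
  have hσ₀ : ∃ σ₀ : absoluteGaloisGroup ℚ_[p], resGal (K := ℚ) ℚ_[p] σ₀ • s = -s := by
    by_contra hall
    push Not at hall
    have hfix : ∀ σ : absoluteGaloisGroup ℚ_[p], resGal (K := ℚ) ℚ_[p] σ • s = s := fun σ ↦
      (hdich _).resolve_right (hall σ)
    set t : AlgebraicClosure ℚ_[p] := closureEmb (K := ℚ) ℚ_[p] s with ht
    have htfix : ∀ σ : AlgebraicClosure ℚ_[p] ≃ₐ[ℚ_[p]] AlgebraicClosure ℚ_[p], σ t = t := by
      intro σ
      have h := apply_resGalAuxOfEmb_apply (closureEmb (K := ℚ) ℚ_[p])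
        ((absoluteGaloisGroup.toAlgEquiv ℚ_[p]).symm σ) s
      have h2 := hfix ((absoluteGaloisGroup.toAlgEquiv ℚ_[p]).symm σ)
      rw [absoluteGaloisGroup.smul_def] at h2
      have h2' : (show AlgebraicClosure ℚ ≃ₐ[ℚ] AlgebraicClosure ℚ from
          resGalAuxOfEmb (closureEmb (K := ℚ) ℚ_[p])
            ((absoluteGaloisGroup.toAlgEquiv ℚ_[p]).symm σ)) s = s := h2
      have h3 := (congrArg (closureEmb (K := ℚ) ℚ_[p]) h2').symm.trans h
      rw [ht]
      exact h3.symm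
    haveI : IsGalois ℚ_[p] (AlgebraicClosure ℚ_[p]) := IsAlgClosure.isGalois ℚ_[p] _
    obtain ⟨t₀, ht₀⟩ : t ∈ Set.range (algebraMap ℚ_[p] (AlgebraicClosure ℚ_[p])) :=
      (InfiniteGalois.mem_range_algebraMap_iff_fixed t).mpr htfix
    have ht2 : t ^ 2 = algebraMap ℚ_[p] (AlgebraicClosure ℚ_[p]) (u : ℚ_[p]) := by
      rw [ht, ← map_pow, hs, geomSqrt_sq, AlgHom.commutes, map_intCast, map_intCast]
    have ht₀2 : t₀ ^ 2 = (u : ℚ_[p]) := by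
      apply (algebraMap ℚ_[p] (AlgebraicClosure ℚ_[p])).injective
      rw [map_pow, ht₀, ht2]
    -- `t₀` is a `p`-adic integer
    have hnorm : ‖t₀‖ ≤ 1 := by
      have h1 : ‖t₀‖ ^ 2 ≤ 1 := by
        rw [← norm_pow, ht₀2]; exact Padic.norm_int_le_one u
      nlinarith [norm_nonneg t₀]
    set z : ℤ_[p] := ⟨t₀, hnorm⟩ with hz
    have hz2 : z ^ 2 = (u : ℤ_[p]) := by
      apply Subtype.ext
      push_cast
      exact ht₀2
    apply hnsq
    refine ⟨PadicInt.toZMod z, ?_⟩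
    rw [← sq, ← map_pow, hz2, map_intCast]
  obtain ⟨σ₀, hσ₀⟩ := hσ₀
  have hσ₀' : ¬ resGal (K := ℚ) ℚ_[p] σ₀ • s = s := fun h ↦ hsne (h.symm.trans hσ₀)
  -- small algebra helpers
  have hneg : ∀ {A : Type} [AddCommGroup A] (x : A), (p : ℤ) • x = 0 → (p - 1) • x = -x := by
    intro A _ x hx
    rw [eq_neg_iff_add_eq_zero, ← succ_nsmul, Nat.sub_add_cancel hp.one_lt.le, ← natCast_zsmul, hx]
  have hmod : ∀ {A : Type} [AddCommGroup A] (x : A) (k : ℤ), (p : ℤ) • x = 0 →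
      k • x = (k % p).toNat • x := by
    intro A _ x k hx
    have hk : k = (p : ℤ) * (k / p) + k % p := (Int.mul_ediv_add_emod k p).symm
    have hnn : 0 ≤ k % p := Int.emod_nonneg k hp0
    conv_lhs => rw [hk, add_zsmul, mul_comm, mul_zsmul, hx, zsmul_zero, zero_add]
    rw [← natCast_zsmul, Int.toNat_of_nonneg hnn]
  -- (2) a prime-to-`p` isogeny `V₀ → W'` and its restriction `V₀[p] ≃ W'[p]`
  obtain ⟨ψ₁, hψ₁⟩ := SkinnerUrban2014.exists_isogeny_not_dvd_degree_of_irreducible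
    (W := V₀) (W' := W') hpQ hirr hW'
  obtain ⟨e₁, he₁, -⟩ := exists_torsionAddEquiv_of_coprime ψ₁ hp.ne_zero
    ((Nat.Prime.coprime_iff_not_dvd hp).mpr hψ₁).symm
  -- the twist isomorphism `V₀^{(u)}(ℚ̄) ≃ V₀(ℚ̄)` (sign-equivariant) and the change of variables to `Vχ`
  obtain ⟨f, hfp, hfm⟩ := exists_addEquiv_geomPoints_quadraticTwist_sign V₀ hu0
  let g : (V₀.quadraticTwist (u : ℚ)).geomPoints ≃+ Vχ.geomPoints :=
    (VariableChange.pointEquivBaseChange (V₀.quadraticTwist (u : ℚ)) v (AlgebraicClosure ℚ)).trans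
      (Affine.Point.congrEquiv
        (congrArg (fun Z : WeierstrassCurve ℚ ↦ Z.baseChange (AlgebraicClosure ℚ)) hv))
  have hg : ∀ (τ : absoluteGaloisGroup ℚ) (X : (V₀.quadraticTwist (u : ℚ)).geomPoints),
      g (τ • X) = τ • g X := by
    intro τ X
    have h1 : VariableChange.pointEquivBaseChange (V₀.quadraticTwist (u : ℚ)) v (AlgebraicClosure ℚ)
        (τ • X) = Affine.Point.map (absoluteGaloisGroup.toAlgEquiv ℚ τ).toAlgHom
          (VariableChange.pointEquivBaseChange (V₀.quadraticTwist (u : ℚ)) v (AlgebraicClosure ℚ) X) :=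
      VariableChange.pointEquivBaseChange_map_algEquiv _ v (absoluteGaloisGroup.toAlgEquiv ℚ τ) X
    exact (congrArg (Affine.Point.congrEquiv
      (congrArg (fun Z : WeierstrassCurve ℚ ↦ Z.baseChange (AlgebraicClosure ℚ)) hv)) h1).trans
        (congrEquiv_smul_of_eq hv (absoluteGaloisGroup.toAlgEquiv ℚ τ) _)
  -- `E[p]` of `Vχ` is irreducible (transport along `g ∘ f⁻¹`)
  have hfsp : ∀ τ : absoluteGaloisGroup ℚ, τ • s = s → ∀ X, f.symm (τ • X) = τ • f.symm X :=
    fun τ hτ X ↦ f.injective (by rw [f.apply_symm_apply, hfp τ hτ, f.apply_symm_apply])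
  have hfsm : ∀ τ : absoluteGaloisGroup ℚ, τ • s = -s → ∀ X, f.symm (τ • X) = -(τ • f.symm X) :=
    fun τ hτ X ↦ f.injective (by rw [f.apply_symm_apply, map_neg, hfm τ hτ, f.apply_symm_apply, neg_neg])
  have hirrχ : Vχ.HasIrreducibleModPGaloisRep p := by
    refine (hasIrreducibleModPGaloisRep_iff_of_addEquiv_geomPoints_signed p (f.symm.trans g)
      fun τ X ↦ ?_).mp hirr
    rw [AddEquiv.trans_apply, AddEquiv.trans_apply]
    rcases hdich τ with hτ | hτ
    · left; rw [hfsp τ hτ, hg]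
    · right; rw [hfsm τ hτ, map_neg, hg]
  -- a prime-to-`p` isogeny `Vχ → W''` and its restriction
  obtain ⟨ψ₂, hψ₂⟩ := SkinnerUrban2014.exists_isogeny_not_dvd_degree_of_irreducible
    (W := Vχ) (W' := W'') hpQ hirrχ hW''
  obtain ⟨e₂, -, he₂c⟩ := exists_torsionAddEquiv_of_coprime ψ₂ hp.ne_zero
    ((Nat.Prime.coprime_iff_not_dvd hp).mpr hψ₂).symm
  -- (3) the rational points as geometric `p`-torsion points fixed by `Γ_{ℚ_p}`
  obtain ⟨P₀, -, hP₀fix, hP₀ne⟩ := exists_geomTorsion_of_padicPoint W' p hp0 P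
    (by rw [natCast_zsmul]; exact hP)
  have hP₀0 : P₀ ≠ 0 := hP₀ne hP0
  obtain ⟨Q₀, -, hQ₀fix, hQ₀ne⟩ := exists_geomTorsion_of_padicPoint W'' p hp0 Q
    (by rw [natCast_zsmul]; exact hQ)
  have hQ₀0 : Q₀ ≠ 0 := hQ₀ne hQ0
  -- (4) transport `P₀` to `W''`
  set X₁ : geomTorsion V₀ (p : ℤ) := e₁.symm P₀ with hX₁
  have hX₁fix : ∀ σ : absoluteGaloisGroup ℚ_[p],
      resGal (K := ℚ) ℚ_[p] σ • (X₁ : V₀.geomPoints) = X₁ := fun σ ↦ by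
    rw [← AddSubgroup.torsionBy.coe_smul]
    congr 1
    apply e₁.injective
    rw [he₁, hX₁, e₁.apply_symm_apply, hP₀fix]
  have hX₁0 : (X₁ : V₀.geomPoints) ≠ 0 := fun h ↦ hP₀0 (by
    rw [← e₁.apply_symm_apply P₀, ← hX₁, show X₁ = 0 from Subtype.ext h, map_zero])
  have hX₁p : (p : ℤ) • (X₁ : V₀.geomPoints) = 0 := (Submodule.mem_torsionBy_iff _ _).mp X₁.2
  set Z : Vχ.geomPoints := g (f.symm (X₁ : V₀.geomPoints)) with hZ
  have hZp : (p : ℤ) • Z = 0 := by rw [hZ, ← map_zsmul, ← map_zsmul, hX₁p, map_zero, map_zero]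
  have hZ0 : Z ≠ 0 := fun h ↦ hX₁0 (by
    rw [hZ, ← map_zero g, ← map_zero f.symm] at h
    exact f.symm.injective (g.injective h))
  set Z' : geomTorsion Vχ (p : ℤ) := ⟨Z, (Submodule.mem_torsionBy_iff _ _).mpr hZp⟩ with hZ'
  set P₁ : W''.geomPoints := ψ₂ Z with hP₁
  have hP₁p : (p : ℤ) • P₁ = 0 := by rw [hP₁, ← map_zsmul, hZp, map_zero]
  have hP₁0 : P₁ ≠ 0 := fun h ↦ hZ0 (by
    have h1 : e₂ Z' = 0 := Subtype.ext (by rw [he₂c, ZeroMemClass.coe_zero]; exact h)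
    rw [AddEquiv.map_eq_zero_iff] at h1
    exact congrArg Subtype.val h1)
  have hP₁σ : ∀ σ : absoluteGaloisGroup ℚ_[p],
      (resGal (K := ℚ) ℚ_[p] σ • s = s ∧ resGal (K := ℚ) ℚ_[p] σ • P₁ = P₁) ∨
      (resGal (K := ℚ) ℚ_[p] σ • s = -s ∧ resGal (K := ℚ) ℚ_[p] σ • P₁ = -P₁) := by
    intro σ
    rcases hdich (resGal (K := ℚ) ℚ_[p] σ) with hτ | hτ
    · left
      refine ⟨hτ, ?_⟩
      rw [hP₁, ← ψ₂.map_smul, hZ, ← hg, ← hfsp _ hτ, hX₁fix]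
    · right
      refine ⟨hτ, ?_⟩
      have h1 := hfsm _ hτ (X₁ : V₀.geomPoints)
      rw [hX₁fix] at h1
      have h2 : resGal (K := ℚ) ℚ_[p] σ • f.symm (X₁ : V₀.geomPoints) = -f.symm X₁ :=
        (neg_eq_iff_eq_neg.mpr h1).symm
      rw [hP₁, ← ψ₂.map_smul, hZ, ← hg, h2, map_neg, map_neg]
  clear_value P₁
  -- (5) the local points `Y_Q` (rational) of `W''`
  set YQ : localPoints W'' ℚ_[p] := pointsMap W'' ℚ_[p] (Q₀ : W''.geomPoints) with hYQ
  have hYQfix : ∀ σ : absoluteGaloisGroup ℚ_[p], σ • YQ = YQ := fun σ ↦ by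
    rw [hYQ, ← pointsMap_smul, ← AddSubgroup.torsionBy.coe_smul, hQ₀fix]
  have hYQp : (p : ℤ) • YQ = 0 := by
    rw [hYQ, ← map_zsmul, (Submodule.mem_torsionBy_iff _ _).mp Q₀.2, map_zero]
  have hYQ0 : YQ ≠ 0 := fun h ↦ hQ₀0 (Subtype.ext (pointsMapOfEmb_injective W'' (closureEmb (K := ℚ) ℚ_[p])
    (by rw [ZeroMemClass.coe_zero, map_zero]; exact h)))
  have hordYQ : addOrderOf YQ = p ^ 1 := by
    rw [pow_one]
    exact addOrderOf_eq_prime (by rw [← natCast_zsmul]; exact hYQp) hYQ0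
  -- independence of `Q₀` and `P₁`
  have hτzsmul : ∀ (τ : absoluteGaloisGroup ℚ) (k : ℤ) (x : W''.geomPoints), τ • (k • x) = k • (τ • x) :=
    fun τ k x ↦ map_zsmul (DistribSMul.toAddMonoidHom W''.geomPoints τ) k x
  have hind : P₁ ∉ AddSubgroup.zmultiples (Q₀ : W''.geomPoints) := by
    intro hmem
    obtain ⟨k, hk⟩ := AddSubgroup.mem_zmultiples_iff.mp hmem
    have h1 : resGal (K := ℚ) ℚ_[p] σ₀ • P₁ = P₁ := by
      rw [← hk, hτzsmul, ← AddSubgroup.torsionBy.coe_smul, hQ₀fix]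
    have h2 : resGal (K := ℚ) ℚ_[p] σ₀ • P₁ = -P₁ := by
      rcases hP₁σ σ₀ with ⟨h, -⟩ | ⟨-, h⟩
      · exact absurd h hσ₀'
      · exact h
    have h3 : (2 : ℕ) • P₁ = 0 := by
      rw [two_nsmul]
      nth_rw 1 [← h1]
      rw [h2, neg_add_cancel]
    have h4 : addOrderOf P₁ ∣ Nat.gcd 2 p := Nat.dvd_gcd (addOrderOf_dvd_of_nsmul_eq_zero h3)
      (addOrderOf_dvd_of_nsmul_eq_zero (by rw [← natCast_zsmul]; exact hP₁p))
    have h5 : Nat.gcd 2 p = 1 := Nat.Coprime.gcd_eq_one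
      ((Nat.coprime_primes Nat.prime_two hp).mpr (by omega))
    rw [h5, Nat.dvd_one, AddMonoid.addOrderOf_eq_one_iff] at h4
    exact hP₁0 h4
  -- every point of `W''[p]` is `m • Q₀ + n • P₁`
  set P₁' : geomTorsion W'' (p : ℤ) := ⟨P₁, (Submodule.mem_torsionBy_iff _ _).mpr hP₁p⟩ with hP₁'
  have hcard : Nat.card (geomTorsion W'' (p : ℤ)) = p ^ 2 := by
    rw [W''.natCard_geomTorsion (p : ℤ) hp0, Int.natAbs_natCast]
  have hpa : p • Q₀ = 0 := Subtype.ext (by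
    rw [AddSubgroupClass.coe_nsmul, ZeroMemClass.coe_zero, ← natCast_zsmul]
    exact (Submodule.mem_torsionBy_iff _ _).mp Q₀.2)
  have hind' : P₁' ∉ AddSubgroup.zmultiples Q₀ := fun h ↦ hind (by
    obtain ⟨k, hk⟩ := AddSubgroup.mem_zmultiples_iff.mp h
    exact AddSubgroup.mem_zmultiples_iff.mpr ⟨k, by
      have := congrArg Subtype.val hk
      rwa [AddSubgroupClass.coe_zsmul] at this⟩)
  have hspan := exists_zsmul_add_zsmul_of_card_eq_sq hcard hQ₀0 hpa hind'
  -- (6) the Weil pairing: a primitive `p`-th root of unity on which `Γ_{ℚ_p}` acts through `±1`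
  let c' : absoluteGaloisGroup ℚ_[p] → ℕ := fun σ ↦ if resGal (K := ℚ) ℚ_[p] σ • s = s then 1 else p - 1
  have h2 : ∀ σ ∈ (Set.univ : Set (absoluteGaloisGroup ℚ_[p])), ∀ R : localPoints W'' ℚ_[p],
      ((p ^ 1 : ℕ) : ℤ) • R = 0 → ∃ d : ℕ, σ • R - c' σ • R = d • YQ := by
    intro σ _ R hR
    rw [pow_one] at hR
    obtain ⟨R₀, hR₀, hσR⟩ := exists_geomTorsion_of_localPoint W'' p hp0 R hR
    obtain ⟨m, n, hmn⟩ := hspan R₀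
    have hR₀' : (R₀ : W''.geomPoints) = m • (Q₀ : W''.geomPoints) + n • P₁ := by
      have := congrArg Subtype.val hmn
      rwa [AddMemClass.coe_add, AddSubgroupClass.coe_zsmul, AddSubgroupClass.coe_zsmul] at this
    have hτQ₀ : resGal (K := ℚ) ℚ_[p] σ • (Q₀ : W''.geomPoints) = Q₀ := by
      rw [← AddSubgroup.torsionBy.coe_smul, hQ₀fix]
    rcases hP₁σ σ with ⟨hsσ, hPσ⟩ | ⟨hsσ, hPσ⟩
    · refine ⟨0, ?_⟩
      have hc : c' σ = 1 := if_pos hsσ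
      rw [hc, one_smul, zero_smul, hσR, AddSubgroup.torsionBy.coe_smul, hR₀', smul_add, hτzsmul,
        hτzsmul, hτQ₀, hPσ, ← hR₀', hR₀, sub_self]
    · have hc : c' σ = p - 1 := if_neg fun h ↦ hsne (h.symm.trans hsσ)
      refine ⟨((2 * m) % p).toNat, ?_⟩
      have hσR' : σ • R = pointsMap W'' ℚ_[p] (m • (Q₀ : W''.geomPoints) + -(n • P₁)) := by
        rw [hσR, AddSubgroup.torsionBy.coe_smul, hR₀', smul_add, hτzsmul, hτzsmul, hτQ₀, hPσ, zsmul_neg]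
      have hR' : R = pointsMap W'' ℚ_[p] (m • (Q₀ : W''.geomPoints) + n • P₁) := by rw [← hR₀, hR₀']
      have e3 : ((2 * m) % p).toNat • YQ = pointsMap W'' ℚ_[p] ((2 * m) • (Q₀ : W''.geomPoints)) := by
        rw [← hmod YQ (2 * m) hYQp, hYQ, map_zsmul]
      rw [hc, hneg R hR, sub_neg_eq_add, hσR', hR', ← map_add, e3]
      congr 1
      rw [mul_zsmul, two_zsmul]
      abel
  obtain ⟨ζ, hζ, hζσ⟩ := W''.localPoints_exists_isPrimitiveRoot_smul_eq_pow ℚ_[p] (k := 1) hordYQ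
    Set.univ (fun _ ↦ 1) c' (fun σ _ ↦ by rw [one_smul]; exact hYQfix σ) h2
  -- (7) contradiction
  rw [pow_one] at hζ
  refine false_of_isPrimitiveRoot_of_forall_smul p hp5 hζ fun σ ↦ ?_
  have h := hζσ σ (Set.mem_univ _)
  rw [mul_one] at h
  by_cases hsσ : resGal (K := ℚ) ℚ_[p] σ • s = s
  · left
    rw [h, show c' σ = 1 from if_pos hsσ, pow_one]
  · right
    rw [h, show c' σ = p - 1 from if_neg hsσ]

/-- **TORS-TWIST (the hypothesis `hTT` of `TwistDegreeStepFiveSevenKP.twistDegreeStepFiveSeven_of_kato_of_twistInputs`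
and of `ManinFrameResidueProperRTameTwistUnitTwist.stub_memberManinUnit_fiveSeven_torsion_of_twistInputs`,
VERBATIM).** For a prime `p ≥ 5`, a prime `q ≠ p` with `q* = (−1)^{⌊q/2⌋} q` a non-square modulo `p`, and a
globally minimal `V₀/ℚ` with `E[p]` irreducible whose `ℚ`-isogeny class contains a curve with a non-zero
`ℚ_p`-rational `p`-torsion point: every globally minimal model `Vχ` of `V₀ ⊗ χ_{q*}` and every globally
minimal `W'' ∼ Vχ` has `W''(ℚ_p)[p] = 0`. Immediate from `eq_zero_of_twist_nonsquare` (minimality and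
`q ≠ p` are not used: a non-square mod `p` is automatically prime to `p`). [cite: SilvermanAEC2009, III.8.1, X.5 Cor. 5.4] -/
theorem torsTwist : ∀ (p : ℕ) [Fact p.Prime] (q : ℕ) [Fact q.Prime] (V₀ : WeierstrassCurve ℚ) [V₀.IsElliptic]
    [V₀.IsGloballyMinimal], 5 ≤ p → Rank1Residual.Irr V₀ p → q ≠ p →
    ¬ IsSquare ((((-1 : ℤ) ^ (q / 2) * q : ℤ)) : ZMod p) →
    (∃ (W' : WeierstrassCurve ℚ) (_ : W'.IsElliptic) (_ : W'.IsGloballyMinimal)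
      (P : (W'.baseChange ℚ_[p]).toAffine.Point), IsIsogenous V₀ W' ∧ P ≠ 0 ∧ p • P = 0) →
    ∀ (Vχ : WeierstrassCurve ℚ) [Vχ.IsElliptic] [Vχ.IsGloballyMinimal] (v : VariableChange ℚ),
    v • V₀.quadraticTwist (((-1 : ℤ) ^ (q / 2) * q : ℤ) : ℚ) = Vχ →
    ∀ (W'' : WeierstrassCurve ℚ) [W''.IsElliptic] [W''.IsGloballyMinimal], IsIsogenous Vχ W'' →
    ∀ Q : (W''.baseChange ℚ_[p]).toAffine.Point, p • Q = 0 → Q = 0 := by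
  intro p _ q _ V₀ _ _ hp5 hirr _ hnsq hT Vχ _ _ v hv W'' _ _ hiso Q hQ
  obtain ⟨W', hE', _, P, hisoW', hP0, hP⟩ := hT
  exact eq_zero_of_twist_nonsquare p hp5 _ hnsq V₀ W' Vχ W'' hirr hisoW' P hP0 hP v hv hiso Q hQ

end Summit.BirchSwinnertonDyer.BirchSwinnertonDyer.Theorems.TorsTwist

end
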